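import Mathlib
import Literature.Analysis.FluidPDE.VectorCalculus

/-!
# `SkeletonEquilibrium` (stmt-NavierStokesRegularity-15400), line `Sketch`: C₄ symmetry transport, α-generic

Stub `stub_transportC4Alpha` of the lead skeleton: the statement of the landed `stub_transportC4`
(p132703, angular speed `α = −5/8` hard-wired) with the angular speed `α` of the drift
`½ y − α e₃ × y` a universally quantified parameter. The four vortex filaments of the relative
equilibrium are sought in C₄-symmetric form `X (j+1) t = R (X j t)`, where
`R v = e₃ × v + ⟪v, e₃⟫ e₃` (`e₃ = EuclideanSpace.single 2 1`) is the rotation by `+90°` about the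
vertical axis, `R (x, y, z) = (−y, x, z)`. The lead's core stub produces the curve clauses
(C², injective, unit speed, curvature `≤ K`, proper), the `ρ`-separation, the integrability of the
regularised Rosenhead integrand and the relative-equilibrium equation for filament `0` only; this
file transports them to all four filaments, for every `α`.

Proof: `R` is (the action of) a linear isometry equivalence `L` of `ℝ³` with `L e₃ = e₃` and
`L (a × b) = L a × L b` (coordinates). Hence `t ↦ L (f t)` has the same regularity,
injectivity, speed, curvature and norm growth as `f` (`deriv (L ∘ f) = L ∘ deriv f`,
`LinearIsometryEquiv.norm_iteratedFDeriv_comp_left`), the Rosenhead integrand of `L ∘ f` at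
`L y` is `L` of the integrand of `f` at `y` (`LinearIsometryEquiv.integrable_comp_iff`,
`LinearIsometry.integral_comp_comm`), and `L` commutes with the drift `½ y − α e₃ × y` for every
`α` (`L (α • e₃ × y) = α • L e₃ × L y = α • e₃ × L y`).
So the filament-`0` clauses of the family `k ↦ X (k + j)` imply those of `k ↦ X (k + j + 1)`;
induction on `j : Fin 4` and the re-indexing `k ↦ k + j` of the image sum (`Equiv.sum_comp`)
conclude.
-/

noncomputable section

open MeasureTheory Filter Topology
open Literature.Analysis.FluidPDE
open scoped RealInnerProductSpace

namespace Summit.NavierStokesRegularity.NavierStokesRegularity.Theorems.SkeletonEquilibrium.Sketch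
set_option linter.dupNamespace false

/-! ### The rotation by `+90°` about `e₃` -/

/-- The symmetry map `v ↦ e₃ × v + ⟪v, e₃⟫ e₃` in coordinates: `(x, y, z) ↦ (−y, x, z)`, the
rotation by `+90°` about `e₃`. [folklore] -/
private theorem tca_rotFormula_coord (v : EuclideanSpace ℝ (Fin 3)) :
    (cross (EuclideanSpace.single (2 : Fin 3) (1 : ℝ)) v
        + ⟪v, EuclideanSpace.single (2 : Fin 3) (1 : ℝ)⟫
            • EuclideanSpace.single (2 : Fin 3) (1 : ℝ)) 0 = -v 1 ∧
    (cross (EuclideanSpace.single (2 : Fin 3) (1 : ℝ)) v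
        + ⟪v, EuclideanSpace.single (2 : Fin 3) (1 : ℝ)⟫
            • EuclideanSpace.single (2 : Fin 3) (1 : ℝ)) 1 = v 0 ∧
    (cross (EuclideanSpace.single (2 : Fin 3) (1 : ℝ)) v
        + ⟪v, EuclideanSpace.single (2 : Fin 3) (1 : ℝ)⟫
            • EuclideanSpace.single (2 : Fin 3) (1 : ℝ)) 2 = v 2 := by
  refine ⟨?_, ?_, ?_⟩ <;>
  simp [cross, cross_apply, EuclideanSpace.inner_single_right]

/-- The symmetry map `v ↦ e₃ × v + ⟪v, e₃⟫ e₃` is (the action of) a linear isometry equivalence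
of `ℝ³` (linear by bilinearity of `×` and of the inner product — the tree's `crossCLM` and
Mathlib's `innerSL`; norm-preserving in coordinates; an equivalence by
`LinearIsometry.toLinearIsometryEquiv`, equal finite dimensions). [folklore] -/
private theorem tca_exists_rot :
    ∃ L : EuclideanSpace ℝ (Fin 3) ≃ₗᵢ[ℝ] EuclideanSpace ℝ (Fin 3), ∀ v,
      L v = cross (EuclideanSpace.single (2 : Fin 3) (1 : ℝ)) v
        + ⟪v, EuclideanSpace.single (2 : Fin 3) (1 : ℝ)⟫ • EuclideanSpace.single (2 : Fin 3) (1 : ℝ) := by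
  set M : EuclideanSpace ℝ (Fin 3) →L[ℝ] EuclideanSpace ℝ (Fin 3) :=
    crossCLM (EuclideanSpace.single (2 : Fin 3) (1 : ℝ))
      + (innerSL ℝ (EuclideanSpace.single (2 : Fin 3) (1 : ℝ))).smulRight
          (EuclideanSpace.single (2 : Fin 3) (1 : ℝ)) with hM
  have happ : ∀ v, M v = cross (EuclideanSpace.single (2 : Fin 3) (1 : ℝ)) v
      + ⟪v, EuclideanSpace.single (2 : Fin 3) (1 : ℝ)⟫ • EuclideanSpace.single (2 : Fin 3) (1 : ℝ) :=
    fun v => by simp [hM, real_inner_comm]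
  have hnorm : ∀ v, ‖M.toLinearMap v‖ = ‖v‖ := fun v => by
    obtain ⟨h0, h1, h2⟩ := tca_rotFormula_coord v
    rw [ContinuousLinearMap.coe_coe, happ, EuclideanSpace.norm_eq, EuclideanSpace.norm_eq,
      Fin.sum_univ_three, Fin.sum_univ_three, h0, h1, h2]
    simp only [Real.norm_eq_abs, sq_abs]
    ring_nf
  exact ⟨(⟨M.toLinearMap, hnorm⟩ : EuclideanSpace ℝ (Fin 3) →ₗᵢ[ℝ] EuclideanSpace ℝ (Fin 3)
      ).toLinearIsometryEquiv rfl, fun v => (happ v) ▸ rfl⟩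

section Transport

variable {L : EuclideanSpace ℝ (Fin 3) ≃ₗᵢ[ℝ] EuclideanSpace ℝ (Fin 3)}

/-- First coordinate of the rotation. [folklore] -/
private theorem tca_rot_apply_zero (hL : ∀ v, L v = cross (EuclideanSpace.single (2 : Fin 3) (1 : ℝ)) v
      + ⟪v, EuclideanSpace.single (2 : Fin 3) (1 : ℝ)⟫ • EuclideanSpace.single (2 : Fin 3) (1 : ℝ))
    (v : EuclideanSpace ℝ (Fin 3)) : L v 0 = -v 1 := by
  rw [hL]; exact (tca_rotFormula_coord v).1

/-- Second coordinate of the rotation. [folklore] -/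
private theorem tca_rot_apply_one (hL : ∀ v, L v = cross (EuclideanSpace.single (2 : Fin 3) (1 : ℝ)) v
      + ⟪v, EuclideanSpace.single (2 : Fin 3) (1 : ℝ)⟫ • EuclideanSpace.single (2 : Fin 3) (1 : ℝ))
    (v : EuclideanSpace ℝ (Fin 3)) : L v 1 = v 0 := by
  rw [hL]; exact (tca_rotFormula_coord v).2.1

/-- Third coordinate of the rotation. [folklore] -/
private theorem tca_rot_apply_two (hL : ∀ v, L v = cross (EuclideanSpace.single (2 : Fin 3) (1 : ℝ)) v
      + ⟪v, EuclideanSpace.single (2 : Fin 3) (1 : ℝ)⟫ • EuclideanSpace.single (2 : Fin 3) (1 : ℝ))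
    (v : EuclideanSpace ℝ (Fin 3)) : L v 2 = v 2 := by
  rw [hL]; exact (tca_rotFormula_coord v).2.2

/-- The rotation fixes its axis `e₃`. [folklore] -/
private theorem tca_rot_e3 (hL : ∀ v, L v = cross (EuclideanSpace.single (2 : Fin 3) (1 : ℝ)) v
      + ⟪v, EuclideanSpace.single (2 : Fin 3) (1 : ℝ)⟫ • EuclideanSpace.single (2 : Fin 3) (1 : ℝ)) :
    L (EuclideanSpace.single (2 : Fin 3) (1 : ℝ)) = EuclideanSpace.single (2 : Fin 3) (1 : ℝ) := by
  ext i
  fin_cases i <;> simp [tca_rot_apply_zero hL, tca_rot_apply_one hL, tca_rot_apply_two hL]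

/-- The rotation is proper: it commutes with the cross product, `L (a × b) = L a × L b`
(coordinates). [folklore] -/
private theorem tca_rot_cross (hL : ∀ v, L v = cross (EuclideanSpace.single (2 : Fin 3) (1 : ℝ)) v
      + ⟪v, EuclideanSpace.single (2 : Fin 3) (1 : ℝ)⟫ • EuclideanSpace.single (2 : Fin 3) (1 : ℝ))
    (a b : EuclideanSpace ℝ (Fin 3)) : L (cross a b) = cross (L a) (L b) := by
  ext i
  fin_cases i <;>
    simp [cross, cross_apply, tca_rot_apply_zero hL, tca_rot_apply_one hL, tca_rot_apply_two hL] <;> ring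

/-! ### Transport of calculus, integrability and the equation along the rotation -/

variable (L) in
/-- `deriv (L ∘ f) = L ∘ deriv f` for a linear isometry equivalence `L` (no differentiability
needed, `LinearIsometryEquiv.comp_fderiv`). [folklore] -/
private theorem tca_deriv_rot_comp (f : ℝ → EuclideanSpace ℝ (Fin 3)) (t : ℝ) :
    deriv (fun s => L (f s)) t = L (deriv f t) := by
  rw [← fderiv_apply_one_eq_deriv, ← fderiv_apply_one_eq_deriv,
    show (fun s => L (f s)) = L ∘ f from rfl, LinearIsometryEquiv.comp_fderiv]
  rfl

variable (L) in
/-- `‖iteratedDeriv n (L ∘ f) t‖ = ‖iteratedDeriv n f t‖` for a linear isometry equivalence `L`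
(`LinearIsometryEquiv.norm_iteratedFDeriv_comp_left`). [folklore] -/
private theorem tca_norm_iteratedDeriv_rot_comp (f : ℝ → EuclideanSpace ℝ (Fin 3)) (t : ℝ) (n : ℕ) :
    ‖iteratedDeriv n (fun s => L (f s)) t‖ = ‖iteratedDeriv n f t‖ := by
  rw [← norm_iteratedFDeriv_eq_norm_iteratedDeriv, ← norm_iteratedFDeriv_eq_norm_iteratedDeriv,
    show (fun s => L (f s)) = L ∘ f from rfl,
    LinearIsometryEquiv.norm_iteratedFDeriv_comp_left]

/-- The regularised Rosenhead integrand is equivariant under the rotation: rotating the field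
point, the source point and the tangent rotates the integrand. [folklore] -/
private theorem tca_integrand_rot (hL : ∀ v, L v = cross (EuclideanSpace.single (2 : Fin 3) (1 : ℝ)) v
      + ⟪v, EuclideanSpace.single (2 : Fin 3) (1 : ℝ)⟫ • EuclideanSpace.single (2 : Fin 3) (1 : ℝ))
    (e : ℝ) (y x v : EuclideanSpace ℝ (Fin 3)) :
    ((‖L y - L x‖ ^ 2 + e ^ 2) ^ (3 / 2 : ℝ))⁻¹ • cross (L v) (L y - L x)
      = L (((‖y - x‖ ^ 2 + e ^ 2) ^ (3 / 2 : ℝ))⁻¹ • cross v (y - x)) := by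
  rw [← map_sub, LinearIsometryEquiv.norm_map, LinearIsometryEquiv.map_smul, tca_rot_cross hL]

/-- Integrability of the Rosenhead integrand at every point transports from a curve `Y₀` to the
rotated curve `L ∘ Y₀` (the integrand at `L x` is `L` of the integrand at `x`;
`LinearIsometryEquiv.integrable_comp_iff`). [folklore] -/
private theorem tca_integrable_step
    (hL : ∀ v, L v = cross (EuclideanSpace.single (2 : Fin 3) (1 : ℝ)) v
      + ⟪v, EuclideanSpace.single (2 : Fin 3) (1 : ℝ)⟫ • EuclideanSpace.single (2 : Fin 3) (1 : ℝ))
    {e : ℝ} {Y₀ : ℝ → EuclideanSpace ℝ (Fin 3)}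
    (H : ∀ y : EuclideanSpace ℝ (Fin 3), Integrable (fun u : ℝ =>
        ((‖y - Y₀ u‖ ^ 2 + e ^ 2) ^ (3 / 2 : ℝ))⁻¹ • cross (deriv Y₀ u) (y - Y₀ u)))
    (y : EuclideanSpace ℝ (Fin 3)) :
    Integrable (fun u : ℝ =>
        ((‖y - L (Y₀ u)‖ ^ 2 + e ^ 2) ^ (3 / 2 : ℝ))⁻¹ •
          cross (deriv (fun s => L (Y₀ s)) u) (y - L (Y₀ u))) := by
  obtain ⟨x, rfl⟩ : ∃ x, L x = y := L.surjective y
  have h : (fun u : ℝ => ((‖L x - L (Y₀ u)‖ ^ 2 + e ^ 2) ^ (3 / 2 : ℝ))⁻¹ •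
          cross (deriv (fun s => L (Y₀ s)) u) (L x - L (Y₀ u)))
      = fun u => L (((‖x - Y₀ u‖ ^ 2 + e ^ 2) ^ (3 / 2 : ℝ))⁻¹ •
          cross (deriv Y₀ u) (x - Y₀ u)) := by
    funext u; rw [tca_deriv_rot_comp]; exact tca_integrand_rot hL e x (Y₀ u) (deriv Y₀ u)
  rw [h, LinearIsometryEquiv.integrable_comp_iff]
  exact H x

/-- The relative-equilibrium equation transports along the rotation: if the image sum over a
family `Y` plus the drift at `y₀` equals `c • w`, then the image sum over the rotated family
`Z k = L ∘ Y k` plus the drift at `L y₀` equals `c • L w` (`L` commutes with the Bochner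
integral, `LinearIsometry.integral_comp_comm`, with the drift `½ y − α e₃ × y` for every `α` since
`L e₃ = e₃`, and with `×`). [folklore] -/
private theorem tca_equation_step
    (hL : ∀ v, L v = cross (EuclideanSpace.single (2 : Fin 3) (1 : ℝ)) v
      + ⟪v, EuclideanSpace.single (2 : Fin 3) (1 : ℝ)⟫ • EuclideanSpace.single (2 : Fin 3) (1 : ℝ))
    {e c α : ℝ} {y₀ w : EuclideanSpace ℝ (Fin 3)} {Y Z : Fin 4 → ℝ → EuclideanSpace ℝ (Fin 3)}
    (hk : ∀ k t, Z k t = L (Y k t))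
    (H : (∑ k : Fin 4, (4 : ℝ) • ∫ u : ℝ,
            ((‖y₀ - Y k u‖ ^ 2 + e ^ 2) ^ (3 / 2 : ℝ))⁻¹ • cross (deriv (Y k) u) (y₀ - Y k u))
          + (1 / 2 : ℝ) • y₀
          - α • cross (EuclideanSpace.single (2 : Fin 3) (1 : ℝ)) y₀ = c • w) :
    (∑ k : Fin 4, (4 : ℝ) • ∫ u : ℝ,
            ((‖L y₀ - Z k u‖ ^ 2 + e ^ 2) ^ (3 / 2 : ℝ))⁻¹ • cross (deriv (Z k) u) (L y₀ - Z k u))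
          + (1 / 2 : ℝ) • L y₀
          - α • cross (EuclideanSpace.single (2 : Fin 3) (1 : ℝ)) (L y₀) = c • L w := by
  have hd : ∀ k u, deriv (Z k) u = L (deriv (Y k) u) := fun k u => by
    rw [show Z k = fun t => L (Y k t) from funext (hk k)]; exact tca_deriv_rot_comp L _ _
  have hI : ∀ k, ∫ u : ℝ, ((‖L y₀ - Z k u‖ ^ 2 + e ^ 2) ^ (3 / 2 : ℝ))⁻¹ •
        cross (deriv (Z k) u) (L y₀ - Z k u)
      = L (∫ u : ℝ, ((‖y₀ - Y k u‖ ^ 2 + e ^ 2) ^ (3 / 2 : ℝ))⁻¹ •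
        cross (deriv (Y k) u) (y₀ - Y k u)) := fun k => by
    have h := L.toLinearIsometry.integral_comp_comm (μ := volume)
      (fun u : ℝ => ((‖y₀ - Y k u‖ ^ 2 + e ^ 2) ^ (3 / 2 : ℝ))⁻¹ •
        cross (deriv (Y k) u) (y₀ - Y k u))
    simp only [LinearIsometryEquiv.coe_toLinearIsometry] at h
    rw [← h]
    congr 1; funext u
    rw [hd, hk]; exact tca_integrand_rot hL e y₀ (Y k u) (deriv (Y k) u)
  have key : (∑ k : Fin 4, (4 : ℝ) • ∫ u : ℝ,
            ((‖L y₀ - Z k u‖ ^ 2 + e ^ 2) ^ (3 / 2 : ℝ))⁻¹ • cross (deriv (Z k) u) (L y₀ - Z k u))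
          + (1 / 2 : ℝ) • L y₀
          - α • cross (EuclideanSpace.single (2 : Fin 3) (1 : ℝ)) (L y₀)
      = L ((∑ k : Fin 4, (4 : ℝ) • ∫ u : ℝ,
            ((‖y₀ - Y k u‖ ^ 2 + e ^ 2) ^ (3 / 2 : ℝ))⁻¹ • cross (deriv (Y k) u) (y₀ - Y k u))
          + (1 / 2 : ℝ) • y₀
          - α • cross (EuclideanSpace.single (2 : Fin 3) (1 : ℝ)) y₀) := by
    simp only [map_sub, map_add, map_sum, LinearIsometryEquiv.map_smul, tca_rot_cross hL, tca_rot_e3 hL,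
      hI]
  rw [key, H, LinearIsometryEquiv.map_smul]

end Transport

/-! ### The stub -/

/-- **C₄ symmetry transport, α-generic (`stub_transportC4Alpha`).** If a family of four curves is
C₄-symmetric, `X (j+1) t = R (X j t)` with `R v = e₃ × v + ⟪v, e₃⟫ e₃` (rotation by `+90°` about
`e₃`), and filament `0` has the curve clauses (C², injective, unit speed, curvature `≤ K`, proper),
is `ρ`-separated from the other three, has an integrable regularised Rosenhead integrand (core `e`)
at every point and satisfies the relative-equilibrium equation with drift `½ X − α e₃ × X` and
slip `V`, then all four filaments have the curve clauses, are pairwise `ρ`-separated, have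
integrable integrands and satisfy the equilibrium equation with the same `α` and the same slip `V`.
This is the landed `stub_transportC4` (p132703) with its literal `α = −5/8` generalised to a
parameter. Proof: the filament-`0` clauses of the shifted family `k ↦ X (k + j)` pass to
`k ↦ X (k + j + 1) = L ∘ X (k + j)` (`L` the linear isometry equivalence acting as `R`, with
`L e₃ = e₃`, `L (a × b) = L a × L b`, hence `L (α • e₃ × y) = α • e₃ × L y`); induct on
`j : Fin 4` and re-index the image sum by `k ↦ k + j`. [folklore] -/
theorem stub_transportC4Alpha :
    ∀ (α e ρ K : ℝ) (X : Fin 4 → ℝ → EuclideanSpace ℝ (Fin 3)) (V : ℝ → ℝ),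
      (∀ (j : Fin 4) (t : ℝ), X (j + 1) t =
          cross (EuclideanSpace.single (2 : Fin 3) (1 : ℝ)) (X j t)
            + inner ℝ (X j t) (EuclideanSpace.single (2 : Fin 3) (1 : ℝ))
                • EuclideanSpace.single (2 : Fin 3) (1 : ℝ)) →
      ContDiff ℝ 2 (X 0) → Function.Injective (X 0) →
      (∀ t, ‖deriv (X 0) t‖ = 1) → (∀ t, ‖iteratedDeriv 2 (X 0) t‖ ≤ K) →
      Tendsto (fun t => ‖X 0 t‖) atTop atTop → Tendsto (fun t => ‖X 0 t‖) atBot atTop →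
      (∀ k : Fin 4, k ≠ 0 → ∀ t u, ρ ≤ ‖X 0 t - X k u‖) →
      (∀ (y : EuclideanSpace ℝ (Fin 3)), Integrable (fun u : ℝ =>
          ((‖y - X 0 u‖ ^ 2 + e ^ 2) ^ (3 / 2 : ℝ))⁻¹ • cross (deriv (X 0) u) (y - X 0 u))) →
      (∀ t, (∑ k : Fin 4, (4 : ℝ) • ∫ u : ℝ,
            ((‖X 0 t - X k u‖ ^ 2 + e ^ 2) ^ (3 / 2 : ℝ))⁻¹ • cross (deriv (X k) u) (X 0 t - X k u))
          + (1 / 2 : ℝ) • X 0 t - α • cross (EuclideanSpace.single (2 : Fin 3) (1 : ℝ)) (X 0 t)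
          = V t • deriv (X 0) t) →
      (∀ j, ContDiff ℝ 2 (X j) ∧ Function.Injective (X j) ∧
          (∀ t, ‖deriv (X j) t‖ = 1) ∧ (∀ t, ‖iteratedDeriv 2 (X j) t‖ ≤ K) ∧
          Tendsto (fun t => ‖X j t‖) atTop atTop ∧ Tendsto (fun t => ‖X j t‖) atBot atTop) ∧
      (∀ j k : Fin 4, j ≠ k → ∀ t u, ρ ≤ ‖X j t - X k u‖) ∧
      (∀ j (y : EuclideanSpace ℝ (Fin 3)), Integrable (fun u : ℝ =>
          ((‖y - X j u‖ ^ 2 + e ^ 2) ^ (3 / 2 : ℝ))⁻¹ • cross (deriv (X j) u) (y - X j u))) ∧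
      (∀ j t, (∑ k : Fin 4, (4 : ℝ) • ∫ u : ℝ,
            ((‖X j t - X k u‖ ^ 2 + e ^ 2) ^ (3 / 2 : ℝ))⁻¹ • cross (deriv (X k) u) (X j t - X k u))
          + (1 / 2 : ℝ) • X j t - α • cross (EuclideanSpace.single (2 : Fin 3) (1 : ℝ)) (X j t)
          = V t • deriv (X j) t) := by
  intro α e ρ K X V hsym h1 h2 h3 h4 h5 h6 h7 h8 h9
  -- the symmetry map as a bundled linear isometry equivalence `L`
  obtain ⟨L, hL⟩ := tca_exists_rot
  have hR : ∀ j t, X (j + 1) t = L (X j t) := fun j t => (hsym j t).trans (hL _).symm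
  -- the filament-`0` clauses of every shifted family `k ↦ X (k + j)`
  have key : ∀ j : Fin 4,
      (ContDiff ℝ 2 (X j) ∧ Function.Injective (X j) ∧ (∀ t, ‖deriv (X j) t‖ = 1) ∧
        (∀ t, ‖iteratedDeriv 2 (X j) t‖ ≤ K) ∧
        Tendsto (fun t => ‖X j t‖) atTop atTop ∧ Tendsto (fun t => ‖X j t‖) atBot atTop) ∧
      (∀ k : Fin 4, k ≠ 0 → ∀ t u, ρ ≤ ‖X j t - X (k + j) u‖) ∧
      (∀ y : EuclideanSpace ℝ (Fin 3), Integrable (fun u : ℝ =>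
          ((‖y - X j u‖ ^ 2 + e ^ 2) ^ (3 / 2 : ℝ))⁻¹ • cross (deriv (X j) u) (y - X j u))) ∧
      (∀ t, (∑ k : Fin 4, (4 : ℝ) • ∫ u : ℝ,
            ((‖X j t - X (k + j) u‖ ^ 2 + e ^ 2) ^ (3 / 2 : ℝ))⁻¹ •
              cross (deriv (X (k + j)) u) (X j t - X (k + j) u))
          + (1 / 2 : ℝ) • X j t
          - α • cross (EuclideanSpace.single (2 : Fin 3) (1 : ℝ)) (X j t)
          = V t • deriv (X j) t) := by
    intro j
    induction j using Fin.induction with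
    | zero =>
      simp only [add_zero]
      exact ⟨⟨h1, h2, h3, h4, h5, h6⟩, h7, h8, h9⟩
    | succ i ih =>
      obtain ⟨⟨c1, c2, c3, c4, c5, c6⟩, c7, c8, c9⟩ := ih
      have e0' : ∀ t, X i.succ t = L (X (Fin.castSucc i) t) := fun t => by
        rw [← Fin.coeSucc_eq_succ]; exact hR _ t
      have e0 : X i.succ = fun t => L (X (Fin.castSucc i) t) := funext e0'
      have ek : ∀ k t, X (k + i.succ) t = L (X (k + Fin.castSucc i) t) := fun k t => by
        rw [← Fin.coeSucc_eq_succ, ← add_assoc]; exact hR _ t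
      have hn : (fun t => ‖X i.succ t‖) = fun t => ‖X (Fin.castSucc i) t‖ :=
        funext fun t => by rw [e0' t, LinearIsometryEquiv.norm_map]
      refine ⟨⟨?_, ?_, ?_, ?_, ?_, ?_⟩, ?_, ?_, ?_⟩
      · rw [e0]; exact L.contDiff.comp c1
      · rw [e0]; exact L.injective.comp c2
      · intro t; rw [e0, tca_deriv_rot_comp, LinearIsometryEquiv.norm_map]; exact c3 t
      · intro t; rw [e0, tca_norm_iteratedDeriv_rot_comp]; exact c4 t
      · rw [hn]; exact c5
      · rw [hn]; exact c6
      · intro k hk t u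
        rw [e0' t, ek k u, ← map_sub, LinearIsometryEquiv.norm_map]
        exact c7 k hk t u
      · intro y; rw [e0]; exact tca_integrable_step hL c8 y
      · intro t
        have hd : deriv (X i.succ) t = L (deriv (X (Fin.castSucc i)) t) := by
          rw [e0, tca_deriv_rot_comp]
        rw [hd, e0' t]
        exact tca_equation_step hL (Y := fun k => X (k + Fin.castSucc i))
          (Z := fun k => X (k + i.succ)) ek (c9 t)
  refine ⟨fun j => (key j).1, ?_, fun j => (key j).2.2.1, ?_⟩
  · intro j k hjk t u
    have h := (key j).2.1 (k - j) (sub_ne_zero.mpr hjk.symm) t u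
    rwa [sub_add_cancel] at h
  · intro j t
    rw [← Equiv.sum_comp (Equiv.addRight j)]
    exact (key j).2.2.2 t

end Summit.NavierStokesRegularity.NavierStokesRegularity.Theorems.SkeletonEquilibrium.Sketch
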